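import Mathlib
import Summits.Parity.BatemanHorn.Theses.IsogenyRedei
import Summits.Parity.BatemanHorn.Theorems.IsogenyRedeiTypeIMainTermPurePart
import Summits.Parity.BatemanHorn.Theorems.IsogenyRedeiTypeIMainTermErrorTerm
import HarnessLib

/-!
# Type-I main term for Bateman–Horn (stmt-Parity-0873), input B5 (part 3):
# `(∑_n 𝓮₀(n)) · ∏_i C(f_i) = C(f)` and the value of the singular series

* `isMultiplicative_proj0` — `[ε_∅]` of a multiplicative `Λ_k`-valued function is multiplicative;
* `tsum_compE_univ_mul_prod_const` — for a Bateman–Horn system `f`: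
  `(∑_n 𝓮₀(n)) ∏_i C(f_i) = C(f)`;
* `tendsto_singularSeries` — **the log-weighted singular series converges to `(−1)^k C(f)`**:
  `∑_{m ≤ N} ∑_{d_1⋯d_k = m} G(d) ∏ μ(d_i) log d_i → (−1)^k C(f)` with `C(f) = batemanHornConst f > 0`.

Everything here is proved.
-/

noncomputable section

open Finset Polynomial ArithmeticFunction Filter Topology
open scoped ArithmeticFunction.Moebius

namespace Summit.Parity.BatemanHorn.Theorems.TypeIMainTerm

open Literature.NumberTheory.Sieve Literature.NumberTheory.LFunctions

variable {k : ℕ} (f : Fin k → ℤ[X])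

/-- `[ε_∅]` of a multiplicative `Λ_k`-valued arithmetic function is multiplicative. -/
theorem isMultiplicative_proj0 {F : ArithmeticFunction (SAlg k)} (hF : F.IsMultiplicative) :
    (proj0 F).IsMultiplicative :=
  ⟨by rw [proj0_apply, hF.map_one, SAlg.coeff_empty_one], fun {m n} hmn => by
    rw [proj0_apply, proj0_apply, proj0_apply, hF.map_mul_of_coprime hmn, SAlg.coeff_empty_mul]⟩

/-- **`(∑_n 𝓮₀(n)) ∏_i C(f_i) = C(f)`**, `C(f) > 0`. -/
theorem tsum_compE_univ_mul_prod_const (hsys : IsBatemanHornSystem f) :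
    (∑' n, compE f Finset.univ n) * ∏ i, batemanHornConst ![f i] = batemanHornConst f ∧
      0 < batemanHornConst f := by
  classical
  have hρi : ∀ i p, p.Prime → polyRootCountMod ![f i] p < p := fun i p hp => rootCount_member_lt f hsys i hp
  have hsysi : ∀ i, IsBatemanHornSystem ![f i] := fun i =>
    ⟨fun j => by fin_cases j; exact hsys.irreducible i, fun j => by fin_cases j; exact hsys.leadingCoeff_pos i,
      fun j j' hjj' => absurd (Subsingleton.elim j j') hjj', fun p hp => hρi i p hp⟩
  obtain ⟨hC, hCpos⟩ := IsBatemanHornSystem.hasBatemanHornConst_holds hsys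
  have hCi : ∀ i, HasBatemanHornConst ![f i] (batemanHornConst ![f i]) := fun i =>
    (IsBatemanHornSystem.hasBatemanHornConst_holds (hsysi i)).1
  refine ⟨?_, hCpos⟩
  -- the Euler product of `𝓮₀`
  set e₀ : ArithmeticFunction ℝ := compE f Finset.univ with he₀
  have hmult : e₀.IsMultiplicative := by
    rw [he₀, ← proj0_eFun]; exact isMultiplicative_proj0 (isMultiplicative_eFun f)
  have hsum : Summable (fun n => ‖e₀ n‖) := by
    simp_rw [Real.norm_eq_abs]
    exact summable_abs_compE f hsys.irreducible hsys.pairwise_not_associated hρi Finset.univ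
  have heuler := hmult.eulerProduct hsum
  -- the local factors
  set E : ℕ → ℝ := fun p => (1 - (polyRootCountMod f p : ℝ) / p) * ∏ i, (1 - rootDensity (f i) p)⁻¹ with hE
  have hloc : ∀ p : ℕ, p.Prime → ∑' v, e₀ (p ^ v) = E p := by
    intro p hp
    rw [he₀, tsum_compE_univ_prime_pow f hp (fun i => hρi i p hp), sum_proj0_aFun_prime_pow f hp]
  have heuler' : Tendsto (fun x : ℕ => ∏ p ∈ Nat.primesLE x, E p) atTop (𝓝 (∑' n, e₀ n)) := by
    have h1 : Tendsto (fun x : ℕ => ∏ p ∈ Nat.primesBelow (x + 1), ∑' v, e₀ (p ^ v)) atTop (𝓝 (∑' n, e₀ n)) :=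
      heuler.comp (tendsto_add_atTop_nat 1)
    refine h1.congr fun x => ?_
    exact Finset.prod_congr rfl fun p hp => hloc p (Nat.prime_of_mem_primesLE hp)
  -- pointwise: `(∏_{p ≤ x} E_p) ∏_i P_i(x) = P(x)`
  have hpoint : ∀ x : ℕ, (∏ p ∈ Nat.primesLE x, E p) * ∏ i, batemanHornPartial ![f i] x =
      batemanHornPartial f x := by
    intro x
    unfold batemanHornPartial
    rw [Finset.prod_comm, ← Finset.prod_mul_distrib]
    refine Finset.prod_congr rfl fun p hp => ?_
    have hp' := Nat.prime_of_mem_primesLE hp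
    have hp0 : (0 : ℝ) < p := by exact_mod_cast hp'.pos
    have hne : ∀ i, (1 - rootDensity (f i) p) ≠ 0 := by
      intro i
      have : rootDensity (f i) p < 1 := by
        rw [rootDensity_apply, div_lt_one hp0]; exact_mod_cast hρi i p hp'
      linarith
    simp only [hE, Fintype.card_fin, pow_one]
    rw [show (∏ i : Fin k, (1 - 1 / (p : ℝ))⁻¹ * (1 - (polyRootCountMod ![f i] p : ℝ) / p)) =
        (1 - 1 / (p : ℝ))⁻¹ ^ k * ∏ i : Fin k, (1 - rootDensity (f i) p) by
      rw [Finset.prod_mul_distrib, Finset.prod_const, Finset.card_univ, Fintype.card_fin]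
      exact congrArg _ (Finset.prod_congr rfl fun i _ => by rw [rootDensity_apply])]
    have hprod : (∏ i : Fin k, (1 - rootDensity (f i) p)⁻¹) * ∏ i : Fin k, (1 - rootDensity (f i) p) = 1 := by
      rw [← Finset.prod_mul_distrib, Finset.prod_congr rfl (fun i _ => inv_mul_cancel₀ (hne i)),
        Finset.prod_const_one]
    calc (1 - (polyRootCountMod f p : ℝ) / p) * (∏ i, (1 - rootDensity (f i) p)⁻¹) *
          ((1 - 1 / (p : ℝ))⁻¹ ^ k * ∏ i, (1 - rootDensity (f i) p))
        = (1 - (polyRootCountMod f p : ℝ) / p) * (1 - 1 / (p : ℝ))⁻¹ ^ k *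
            ((∏ i, (1 - rootDensity (f i) p)⁻¹) * ∏ i, (1 - rootDensity (f i) p)) := by ring
      _ = (1 - 1 / (p : ℝ))⁻¹ ^ k * (1 - (polyRootCountMod f p : ℝ) / p) := by rw [hprod]; ring
  -- limits
  have hlhs : Tendsto (fun x : ℕ => (∏ p ∈ Nat.primesLE x, E p) * ∏ i, batemanHornPartial ![f i] x) atTop
      (𝓝 ((∑' n, e₀ n) * ∏ i, batemanHornConst ![f i])) :=
    heuler'.mul (tendsto_finsetProd _ fun i _ => hCi i)
  have hrhs : Tendsto (fun x : ℕ => (∏ p ∈ Nat.primesLE x, E p) * ∏ i, batemanHornPartial ![f i] x) atTop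
      (𝓝 (batemanHornConst f)) := by
    simp_rw [hpoint]; exact hC
  exact tendsto_nhds_unique hlhs hrhs

/-- **The log-weighted singular series of the Type-I main term converges to `(−1)^k C(f)`.** -/
theorem tendsto_singularSeries (hsys : IsBatemanHornSystem f) :
    Tendsto (fun N : ℕ => ∑ m ∈ Ioc 0 N, ∑ d ∈ Nat.finMulAntidiag k m,
      sysDensity f d * ∏ i, ((μ (d i) : ℝ) * Real.log (d i))) atTop
      (𝓝 ((-1) ^ k * batemanHornConst f)) := by
  have hρi : ∀ i p, p.Prime → polyRootCountMod ![f i] p < p := fun i p hp => rootCount_member_lt f hsys i hp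
  have h := tendsto_sum_coeff_univ_aFun f hsys.irreducible hsys.pairwise_not_associated
    (natDegree_member_pos f hsys) hsys.leadingCoeff_pos hρi
  obtain ⟨hval, -⟩ := tsum_compE_univ_mul_prod_const f hsys
  have hlim : (∑' n, SAlg.coeff (eFun f n) ∅) * ∏ i, (-batemanHornConst ![f i]) =
      (-1) ^ k * batemanHornConst f := by
    rw [← hval]
    have : ∏ i : Fin k, (-batemanHornConst ![f i]) = (-1) ^ k * ∏ i, batemanHornConst ![f i] := by
      rw [Finset.prod_neg, Finset.card_univ, Fintype.card_fin]
    rw [this]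
    simp only [compE_apply, Finset.sdiff_self]
    ring
  rw [← hlim]
  refine h.congr fun N => Finset.sum_congr rfl fun m _ => ?_
  rw [coeff_univ_aFun]

end Summit.Parity.BatemanHorn.Theorems.TypeIMainTerm

end

/-!
# Type-I main term for Bateman–Horn (stmt-Parity-0873): assembly

* `abs_typeISum_sub_main_le` — `|T(x) − (x+1−n₀) M(⌊x^{1-η}⌋)| ≤ K₀ + E(x^{1-η})`, where `T` is the
  route's double sum, `M` the partial sum of the log-weighted singular series and `E` the error sum
  of input D2;
* `typeIMainTerm_proof` — **the route statement `TypeIMainTerm`**: `(−1)^k T(x) ∼ C(f) x` with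
  `C(f) = batemanHornConst f` the Bateman–Horn constant.

Everything here is proved.
-/

noncomputable section

open Finset Polynomial ArithmeticFunction Filter Topology Asymptotics
open scoped ArithmeticFunction.Moebius

namespace Summit.Parity.BatemanHorn.Theorems.TypeIMainTerm

open Literature.NumberTheory.Sieve Literature.NumberTheory.LFunctions

variable {k : ℕ} (f : Fin k → ℤ[X])

/-- **Main decomposition.** With `n₀` such that all `f_i(n) ≥ 1` for `n ≥ n₀`:
`|T(x) − (x + 1 − n₀) · M(X)| ≤ K₀ + E(X)`, `X = x^{1-η}`. -/
theorem abs_typeISum_sub_main_le {n₀ : ℕ} (hn₀1 : 1 ≤ n₀)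
    (hn₀ : ∀ n : ℕ, n₀ ≤ n → ∀ i, 1 ≤ (f i).eval (n : ℤ)) {X : ℝ} (hX : 0 ≤ X) (x : ℕ) :
    |(∑ n ∈ Icc 1 x, ∑ d ∈ Fintype.piFinset (fun i => (((f i).eval (n : ℤ)).toNat).divisors),
        if ∏ i, (d i : ℝ) ≤ X then ∏ i, ((μ (d i) : ℝ) * Real.log (d i)) else 0) -
      ((x + 1 - n₀ : ℕ) : ℝ) * ∑ m ∈ Ioc 0 ⌊X⌋₊, ∑ d ∈ Nat.finMulAntidiag k m,
        sysDensity f d * ∏ i, ((μ (d i) : ℝ) * Real.log (d i))| ≤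
    (∑ n ∈ range n₀, ∑ d ∈ Fintype.piFinset (fun i => (((f i).eval (n : ℤ)).toNat).divisors),
        |∏ i, ((μ (d i) : ℝ) * Real.log (d i))|) +
      ∑ d ∈ (Fintype.piFinset fun _ : Fin k => Icc 1 ⌊X⌋₊).filter (fun d => ∏ i, (d i : ℝ) ≤ X),
        |wt d| * (sysCount f d : ℝ) := by
  classical
  set I : ℕ → ℝ := fun n => ∑ d ∈ Fintype.piFinset (fun i => (((f i).eval (n : ℤ)).toNat).divisors),
    if ∏ i, (d i : ℝ) ≤ X then ∏ i, ((μ (d i) : ℝ) * Real.log (d i)) else 0 with hI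
  set T := (Fintype.piFinset fun _ : Fin k => Icc 1 ⌊X⌋₊).filter (fun d => ∏ i, (d i : ℝ) ≤ X)
    with hT
  set N : ℕ := x + 1 - n₀ with hN
  -- split `n < n₀` / `n ≥ n₀`
  have hsplit : ∑ n ∈ Icc 1 x, I n =
      ∑ n ∈ (Icc 1 x).filter (fun n => n < n₀), I n + ∑ n ∈ Icc n₀ x, I n := by
    rw [← Finset.sum_filter_add_sum_filter_not (Icc 1 x) (fun n => n < n₀)]
    congr 1
    refine Finset.sum_congr ?_ fun _ _ => rfl
    ext n
    simp only [Finset.mem_filter, Finset.mem_Icc, not_lt]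
    omega
  -- the small part
  have hsmall : |∑ n ∈ (Icc 1 x).filter (fun n => n < n₀), I n| ≤
      ∑ n ∈ range n₀, ∑ d ∈ Fintype.piFinset (fun i => (((f i).eval (n : ℤ)).toNat).divisors),
        |∏ i, ((μ (d i) : ℝ) * Real.log (d i))| := by
    refine (Finset.abs_sum_le_sum_abs _ _).trans ?_
    have hsub : (Icc 1 x).filter (fun n => n < n₀) ⊆ range n₀ := fun n hn => by
      rw [Finset.mem_filter] at hn; exact Finset.mem_range.mpr hn.2
    refine (Finset.sum_le_sum_of_subset_of_nonneg hsub fun _ _ _ => abs_nonneg _).trans ?_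
    refine Finset.sum_le_sum fun n _ => (Finset.abs_sum_le_sum_abs _ _).trans
      (Finset.sum_le_sum fun d _ => ?_)
    split_ifs
    · exact le_rfl
    · rw [abs_zero]; exact abs_nonneg _
  -- the main part
  have hmain : ∑ n ∈ Icc n₀ x, I n = ∑ d ∈ T, wt d * ((sysSols f d (Icc n₀ x)).card : ℝ) := by
    rw [← sum_inner_swap]
    refine Finset.sum_congr rfl fun n hn => ?_
    rw [Finset.mem_Icc] at hn
    exact inner_sum_eq f (hn₀ n hn.1) X
  have hM : ∑ d ∈ T, wt d * sysDensity f d = ∑ m ∈ Ioc 0 ⌊X⌋₊, ∑ d ∈ Nat.finMulAntidiag k m,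
      sysDensity f d * ∏ i, ((μ (d i) : ℝ) * Real.log (d i)) := by
    rw [hT, sum_box_filter_eq_sum_Ioc (fun d => wt d * sysDensity f d) hX]
    refine Finset.sum_congr rfl fun m _ => Finset.sum_congr rfl fun d _ => ?_
    rw [wt_apply, mul_comm]
  have herr : |∑ d ∈ T, wt d * ((sysSols f d (Icc n₀ x)).card : ℝ) - (N : ℝ) * ∑ d ∈ T, wt d * sysDensity f d|
      ≤ ∑ d ∈ T, |wt d| * (sysCount f d : ℝ) := by
    rw [Finset.mul_sum, ← Finset.sum_sub_distrib]
    refine (Finset.abs_sum_le_sum_abs _ _).trans (Finset.sum_le_sum fun d hd => ?_)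
    rw [hT, Finset.mem_filter, Fintype.mem_piFinset] at hd
    have hd1 : ∀ i, 0 < d i := fun i => (Finset.mem_Icc.mp (hd.1 i)).1
    rw [show wt d * ((sysSols f d (Icc n₀ x)).card : ℝ) - (N : ℝ) * (wt d * sysDensity f d) =
      wt d * (((sysSols f d (Icc n₀ x)).card : ℝ) - (N : ℝ) * sysDensity f d) by ring, abs_mul]
    exact mul_le_mul_of_nonneg_left (abs_card_sysSols_Icc_sub_le f d hd1 n₀ x) (abs_nonneg _)
  -- assemble
  rw [hsplit, hmain, ← hM]
  calc |∑ n ∈ (Icc 1 x).filter (fun n => n < n₀), I n +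
          ∑ d ∈ T, wt d * ((sysSols f d (Icc n₀ x)).card : ℝ) - (N : ℝ) * ∑ d ∈ T, wt d * sysDensity f d|
      = |∑ n ∈ (Icc 1 x).filter (fun n => n < n₀), I n +
          (∑ d ∈ T, wt d * ((sysSols f d (Icc n₀ x)).card : ℝ) - (N : ℝ) * ∑ d ∈ T, wt d * sysDensity f d)| := by
        ring_nf
    _ ≤ _ := (abs_add_le _ _).trans (add_le_add hsmall herr)

end Summit.Parity.BatemanHorn.Theorems.TypeIMainTerm

namespace Summit.Parity.BatemanHorn.Theorems

open Literature.NumberTheory.Sieve Literature.NumberTheory.LFunctions TypeIMainTerm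

/-- **Type-I main term for Bateman–Horn (route `IsogenyRedei`, item `TypeIMainTerm`).**
For a Bateman–Horn system `f_1, …, f_k` and `0 < η < 1`,
`(−1)^k ∑_{n ≤ x} ∑_{d_i ∣ f_i(n), ∏ d_i ≤ x^{1−η}} ∏ μ(d_i) log d_i ∼ C(f) · x`
with `C(f) = batemanHornConst f > 0` the Bateman–Horn singular series. -/
theorem typeIMainTerm_proof : Summit.Parity.BatemanHorn.Theses.IsogenyRedei.TypeIMainTerm := by
  intro k f hsys η hη hη1
  classical
  obtain ⟨hC, hCpos⟩ := IsBatemanHornSystem.hasBatemanHornConst_holds hsys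
  refine ⟨batemanHornConst f, hCpos, hC, ?_⟩
  set C := batemanHornConst f with hCdef
  obtain ⟨n₀, hn₀1, hn₀⟩ := exists_forall_eval_pos f hsys
  obtain ⟨CE, c, hCE, hE⟩ := exists_error_bound f hsys
  -- notation
  set T : ℕ → ℝ := fun x => ∑ n ∈ Icc 1 x,
    ∑ d ∈ Fintype.piFinset (fun i => (((f i).eval (n : ℤ)).toNat).divisors),
      if ∏ i, (d i : ℝ) ≤ (x : ℝ) ^ (1 - η) then ∏ i, ((μ (d i) : ℝ) * Real.log (d i)) else 0 with hT
  set M : ℕ → ℝ := fun x => ∑ m ∈ Ioc 0 ⌊(x : ℝ) ^ (1 - η)⌋₊, ∑ d ∈ Nat.finMulAntidiag k m,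
    sysDensity f d * ∏ i, ((μ (d i) : ℝ) * Real.log (d i)) with hM
  set K₀ : ℝ := ∑ n ∈ range n₀, ∑ d ∈ Fintype.piFinset (fun i => (((f i).eval (n : ℤ)).toNat).divisors),
    |∏ i, ((μ (d i) : ℝ) * Real.log (d i))| with hK₀
  set E : ℕ → ℝ := fun x => ∑ d ∈ (Fintype.piFinset fun _ : Fin k => Icc 1 ⌊(x : ℝ) ^ (1 - η)⌋₊).filter
    (fun d => ∏ i, (d i : ℝ) ≤ (x : ℝ) ^ (1 - η)), |wt d| * (sysCount f d : ℝ) with hEdef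
  have hX0 : ∀ x : ℕ, 0 ≤ (x : ℝ) ^ (1 - η) := fun x => Real.rpow_nonneg (Nat.cast_nonneg _) _
  have hdec : ∀ x : ℕ, |T x - ((x + 1 - n₀ : ℕ) : ℝ) * M x| ≤ K₀ + E x := fun x =>
    abs_typeISum_sub_main_le f hn₀1 hn₀ (hX0 x) x
  -- (i) `T − (x+1−n₀) M = o(x)`
  have h1 : (fun x : ℕ => T x - ((x + 1 - n₀ : ℕ) : ℝ) * M x) =o[atTop] (fun x : ℕ => (x : ℝ)) := by
    have hK : (fun _ : ℕ => K₀) =o[atTop] (fun x : ℕ => (x : ℝ)) :=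
      isLittleO_const_left.mpr (Or.inr (tendsto_norm_atTop_atTop.comp tendsto_natCast_atTop_atTop))
    have hE' : (fun x : ℕ => CE * (x : ℝ) ^ (1 - η) * Real.log ((x : ℝ) ^ (1 - η)) ^ c) =o[atTop]
        (fun x : ℕ => (x : ℝ)) := isLittleO_rpow_mul_log_pow hη CE c
    have hsum := hK.add hE'
    refine IsBigO.trans_isLittleO ?_ hsum
    refine IsBigO.of_bound 1 ?_
    -- eventually `X = x^{1-η} ≥ 2`
    have hXinf : Tendsto (fun x : ℕ => (x : ℝ) ^ (1 - η)) atTop atTop :=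
      (tendsto_rpow_atTop (by linarith)).comp tendsto_natCast_atTop_atTop
    filter_upwards [hXinf.eventually_ge_atTop 2] with x hx
    rw [one_mul, Real.norm_eq_abs, Real.norm_eq_abs]
    exact (hdec x).trans ((add_le_add le_rfl (hE _ hx)).trans (le_abs_self _))
  -- (ii) `(x+1−n₀)((−1)^k M − C) = o(x)`
  have h2 : (fun x : ℕ => ((x + 1 - n₀ : ℕ) : ℝ) * ((-1) ^ k * M x - C)) =o[atTop]
      (fun x : ℕ => (x : ℝ)) := by
    have hO : (fun x : ℕ => ((x + 1 - n₀ : ℕ) : ℝ)) =O[atTop] (fun x : ℕ => (x : ℝ)) := by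
      refine IsBigO.of_bound 2 ?_
      filter_upwards [eventually_ge_atTop 1] with x hx
      rw [Real.norm_eq_abs, Real.norm_eq_abs, abs_of_nonneg (Nat.cast_nonneg _),
        abs_of_nonneg (Nat.cast_nonneg _)]
      have : ((x + 1 - n₀ : ℕ) : ℝ) ≤ x + 1 := by
        have h := Nat.sub_le (x + 1) n₀
        exact_mod_cast h
      have hx1 : (1 : ℝ) ≤ x := by exact_mod_cast hx
      linarith
    have hlim : Tendsto (fun x : ℕ => (-1 : ℝ) ^ k * M x - C) atTop (𝓝 0) := by
      have hfl : Tendsto (fun x : ℕ => ⌊(x : ℝ) ^ (1 - η)⌋₊) atTop atTop :=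
        tendsto_nat_floor_atTop.comp ((tendsto_rpow_atTop (by linarith)).comp tendsto_natCast_atTop_atTop)
      have hS := (tendsto_singularSeries f hsys).comp hfl
      have hS' : Tendsto (fun x : ℕ => (-1 : ℝ) ^ k * M x) atTop (𝓝 ((-1) ^ k * ((-1) ^ k * C))) :=
        hS.const_mul _
      rw [← mul_assoc, ← mul_pow, neg_one_mul, neg_neg, one_pow, one_mul] at hS'
      rw [← sub_self C]
      exact hS'.sub_const C
    have ho : (fun x : ℕ => (-1 : ℝ) ^ k * M x - C) =o[atTop] (fun _ : ℕ => (1 : ℝ)) :=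
      (isLittleO_one_iff ℝ).mpr hlim
    have := hO.mul_isLittleO ho
    simpa only [mul_one] using this
  -- (iii) the constant
  have h3 : (fun _ : ℕ => C * (1 - n₀ : ℝ)) =o[atTop] (fun x : ℕ => (x : ℝ)) :=
    isLittleO_const_left.mpr (Or.inr (tendsto_norm_atTop_atTop.comp tendsto_natCast_atTop_atTop))
  -- combine
  have hsum := ((h1.const_mul_left ((-1 : ℝ) ^ k)).add h2).add h3
  have heq : ∀ᶠ x : ℕ in atTop, (-1 : ℝ) ^ k * (T x - ((x + 1 - n₀ : ℕ) : ℝ) * M x) +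
      ((x + 1 - n₀ : ℕ) : ℝ) * ((-1) ^ k * M x - C) + C * (1 - n₀ : ℝ) =
      (-1 : ℝ) ^ k * T x - C * x := by
    filter_upwards [eventually_ge_atTop n₀] with x hx
    have : ((x + 1 - n₀ : ℕ) : ℝ) = (x : ℝ) + 1 - n₀ := by
      rw [Nat.cast_sub (by omega)]; push_cast; ring
    rw [this]; ring
  have h4 : (fun x : ℕ => (-1 : ℝ) ^ k * T x - C * x) =o[atTop] (fun x : ℕ => (x : ℝ)) :=
    hsum.congr' heq EventuallyEq.rfl
  -- `IsEquivalent`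
  show ((fun x : ℕ => (-1 : ℝ) ^ k * T x) - fun x : ℕ => C * (x : ℝ)) =o[atTop] fun x : ℕ => C * (x : ℝ)
  exact (h4.congr' (Eventually.of_forall fun x => by simp [Pi.sub_apply]) EventuallyEq.rfl).trans_isBigO
    (isBigO_self_const_mul hCpos.ne' _ _)

end Summit.Parity.BatemanHorn.Theorems

end
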